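import Summits.KontsevichZagierPeriods.KontsevichZagierPeriods.Theorems.LinRedNormalFormArrangementNormalFormStubRebaseSimpleZeroNestedSuper

/-!
# Stub `stub_rebaseSimpleZeroMany`, part `rebaseSimpleZeroMany_common` (crux `ArrangementNormalForm`,
line `janus-bands`) — brick `ChainCone`

The CONE ESTIMATES at a pinch vertex for ANY number `K` of fibres over a one-dimensional base,
by domination with a product of one-variable sub-power singularities
(`RebaseChain.integrableOn_of_subpower`: `|f| ≤ C |y − y₀|^{−γ₀} ∏ₗ |tₗ − cₗ|^{−γₗ}` with all
exponents `< 1` on a bounded set is integrable — `Integrable.fintype_prod`, no Fubini):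
* `RebaseChain.integrableOn_coneK` — the `K`-fibre CONE ESTIMATE: if every fibre stays in the
  cone `0 < |tₗ − t₀| < β |y − y₀|` and `|f| ≤ C/|y − y₀|`, then `f` is integrable
  (`1/|y − y₀| ≤ β^{1/2} |y − y₀|^{−1/2} ∏ₗ |tₗ − t₀|^{−1/(2K)}`);
* `RebaseChain.integrableOn_logConeK` — the `K`-fibre LOG-CONE ESTIMATE: if the fibres of a set
  `S` stay above the cone, `α |y − y₀| ≤ |tₗ − cₗ|`, and `|f| ≤ C ∏_{l ∈ S} 1/|tₗ − cₗ|`, then `f`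
  is integrable (`1/|tₗ − cₗ| ≤ (α|y − y₀|)^{−δ} |tₗ − cₗ|^{−(1−δ)}`, `δ = 1/(2K)`).
Registered: `rebaseSimpleZeroMany_coneK`.

References: M. Kontsevich, D. Zagier, *Periods* (2001), §1.2.
-/

noncomputable section

open Set MeasureTheory MvPolynomial
open Literature.NumberTheory.Transcendental Literature.ModelTheory.ExponentialFields

namespace Summit.KontsevichZagierPeriods.ArrangementNormalForm.JanusBands

namespace RebaseChain

open SeparatePos RebasePos RebaseZero

variable {K : ℕ}

/-! ### Products over the coordinates -/

/-- A product over all coordinates splits into the base factor and the fibre factors. [folklore] -/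
theorem prod_coord (G : Fin (0 + 1 + K) → ℝ → ℝ) (z : Fin (0 + 1 + K) → ℝ) :
    ∏ i, G i (z i) = G (yIdx K) (yv z) * ∏ l, G (tIdx l) (tv z l) := by
  rw [Fin.prod_univ_add, Fin.prod_univ_succ, Fin.prod_univ_zero, mul_one, RebaseZero.eq_last 0]
  rfl

/-- **Sub-power domination.** If on a measurable set `W` the base stays at distance `< R` from
`y₀` and every fibre at positive distance `< R` from `cₗ`, and
`|f| ≤ C |y − y₀|^{−γ₀} ∏ₗ |tₗ − cₗ|^{−γₗ}` with all exponents `γ < 1`, then `f` is integrable on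
`W` (domination by a product of one-variable integrable functions). [folklore] -/
theorem integrableOn_of_subpower {f : (Fin (0 + 1 + K) → ℝ) → ℝ} {W : Set (Fin (0 + 1 + K) → ℝ)}
    (hWm : MeasurableSet W) (hf : AEStronglyMeasurable f (volume.restrict W))
    {y₀ γ₀ C R : ℝ} {c γ : Fin K → ℝ} (hγ₀ : γ₀ < 1) (hγ : ∀ l, γ l < 1)
    (hW : ∀ z ∈ W, (0 < |yv z - y₀| ∧ |yv z - y₀| < R) ∧ ∀ l, 0 < |tv z l - c l| ∧ |tv z l - c l| < R)
    (hfC : ∀ z ∈ W, |f z| ≤ C * |yv z - y₀| ^ (-γ₀) * ∏ l, |tv z l - c l| ^ (-(γ l))) :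
    IntegrableOn f W := by
  obtain ⟨F₀, hF₀i, hF₀⟩ := RebaseNest.exists_dominator_rpow (-γ₀) R (by linarith)
  choose F hFi hF using fun l => RebaseNest.exists_dominator_rpow (-(γ l)) R (by linarith [hγ l])
  set G : Fin (0 + 1 + K) → ℝ → ℝ := Fin.addCases (motive := fun _ => ℝ → ℝ) (fun _ y => F₀ (y - y₀))
    (fun l t => F l (t - c l)) with hG
  have hGy : G (yIdx K) = fun y => F₀ (y - y₀) := by rw [hG, yIdx, Fin.addCases_left]
  have hGt : ∀ l, G (tIdx l) = fun t => F l (t - c l) := fun l => by rw [hG, tIdx, Fin.addCases_right]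
  have hGi : ∀ i, Integrable (G i) := by
    refine Fin.addCases (fun j => ?_) (fun l => ?_)
    · rw [RebaseZero.eq_last j, show Fin.castAdd K (Fin.last 0) = yIdx K from rfl, hGy]
      exact hF₀i.comp_sub_right y₀
    · rw [show Fin.natAdd (0 + 1) l = tIdx l from rfl, hGt]
      exact (hFi l).comp_sub_right (c l)
  have hprod : Integrable (fun z : Fin (0 + 1 + K) → ℝ => |C| * ∏ i, G i (z i)) :=
    (Integrable.fintype_prod (μ := fun _ => volume) hGi).const_mul |C|
  refine Integrable.mono' hprod.integrableOn hf ((ae_restrict_iff' hWm).2 (Filter.Eventually.of_forall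
    fun z hz => ?_))
  obtain ⟨⟨hy0, hyR⟩, ht⟩ := hW z hz
  rw [Real.norm_eq_abs, prod_coord, hGy]
  simp only [hGt, hF₀ _ hy0 hyR]
  rw [Finset.prod_congr rfl fun l _ => hF l _ (ht l).1 (ht l).2]
  have hP : 0 ≤ |yv z - y₀| ^ (-γ₀) * ∏ l, |tv z l - c l| ^ (-(γ l)) :=
    mul_nonneg (Real.rpow_nonneg (abs_nonneg _) _)
      (Finset.prod_nonneg fun l _ => Real.rpow_nonneg (abs_nonneg _) _)
  calc |f z| ≤ C * |yv z - y₀| ^ (-γ₀) * ∏ l, |tv z l - c l| ^ (-(γ l)) := hfC z hz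
    _ = C * (|yv z - y₀| ^ (-γ₀) * ∏ l, |tv z l - c l| ^ (-(γ l))) := by ring
    _ ≤ |C| * (|yv z - y₀| ^ (-γ₀) * ∏ l, |tv z l - c l| ^ (-(γ l))) :=
        mul_le_mul_of_nonneg_right (le_abs_self C) hP

/-! ### The cone estimate -/

/-- Power bookkeeping: `x⁻¹ = x^{−(1−δ)} x^{−δ}`. [folklore] -/
theorem inv_eq_rpow_mul (δ : ℝ) {x : ℝ} (hx : 0 < x) :
    x⁻¹ = x ^ (-(1 - δ)) * x ^ (-δ) := by
  rw [← Real.rpow_add hx, show (-(1 - δ)) + -δ = -1 by ring, Real.rpow_neg_one]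

/-- **The `K`-fibre cone estimate** (`K = n + 1 ≥ 1` fibres over a one-dimensional base). If on
a measurable set `W` every fibre stays in the cone `0 < |tₗ − t₀| < β |y − y₀|` with
`0 < |y − y₀| ≤ R`, and `|f| ≤ C/|y − y₀|` on `W` with `f` a.e.-strongly measurable there, then
`f` is integrable on `W`. [folklore] -/
theorem integrableOn_coneK {n : ℕ} {f : (Fin (0 + 1 + (n + 1)) → ℝ) → ℝ}
    {W : Set (Fin (0 + 1 + (n + 1)) → ℝ)} (hWm : MeasurableSet W)
    (hf : AEStronglyMeasurable f (volume.restrict W)) {y₀ t₀ β C R : ℝ} (hβ : 0 < β)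
    (hW : ∀ z ∈ W, (0 < |yv z - y₀| ∧ |yv z - y₀| ≤ R) ∧
      ∀ l, 0 < |tv z l - t₀| ∧ |tv z l - t₀| < β * |yv z - y₀|)
    (hfC : ∀ z ∈ W, |f z| ≤ C / |yv z - y₀|) : IntegrableOn f W := by
  set δ : ℝ := 1 / (2 * ((n : ℝ) + 1)) with hδ
  have hn1 : (0 : ℝ) < (n : ℝ) + 1 := by positivity
  have hδ0 : 0 < δ := by rw [hδ]; positivity
  have hδn : δ * ((n + 1 : ℕ) : ℝ) = 1 / 2 := by
    rw [hδ]; push_cast; field_simp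
  have hδ1 : δ < 1 := by
    rw [hδ, div_lt_one (by positivity)]; nlinarith
  refine integrableOn_of_subpower hWm hf (y₀ := y₀) (γ₀ := 1 / 2) (C := |C| * β ^ (1 / 2 : ℝ))
    (R := max (R + 1) (β * R + 1)) (c := fun _ => t₀) (γ := fun _ => δ) (by norm_num) (fun _ => hδ1)
    (fun z hz => ?_) (fun z hz => ?_)
  · obtain ⟨⟨hy0, hyR⟩, ht⟩ := hW z hz
    refine ⟨⟨hy0, by have := le_max_left (R + 1) (β * R + 1); linarith⟩, fun l => ⟨(ht l).1, ?_⟩⟩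
    have h1 : β * |yv z - y₀| ≤ β * R := mul_le_mul_of_nonneg_left hyR hβ.le
    have := le_max_right (R + 1) (β * R + 1)
    linarith [(ht l).2]
  · obtain ⟨⟨hy0, -⟩, ht⟩ := hW z hz
    set Y := |yv z - y₀| with hY
    have hβY : 0 < β * Y := mul_pos hβ hy0
    -- each fibre factor dominates `(β Y)^{−δ}`
    have hl : ∀ l, (β * Y) ^ (-δ) ≤ |tv z l - t₀| ^ (-δ) := fun l =>
      Real.rpow_le_rpow_of_nonpos (ht l).1 (ht l).2.le (by linarith)
    have hprod : ((β * Y) ^ (-δ)) ^ (n + 1) ≤ ∏ l : Fin (n + 1), |tv z l - t₀| ^ (-δ) := by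
      rw [← Fin.prod_const]
      exact Finset.prod_le_prod (fun l _ => Real.rpow_nonneg hβY.le _) fun l _ => hl l
    have hpow : ((β * Y) ^ (-δ)) ^ (n + 1) = β ^ (-(1 / 2 : ℝ)) * Y ^ (-(1 / 2 : ℝ)) := by
      rw [← Real.rpow_mul_natCast hβY.le, show -δ * ((n + 1 : ℕ) : ℝ) = -(1 / 2) by
        rw [neg_mul, hδn], Real.mul_rpow hβ.le hy0.le]
    rw [hpow] at hprod
    have hβh : 0 < β ^ (1 / 2 : ℝ) := Real.rpow_pos_of_pos hβ _
    have hβinv : β ^ (1 / 2 : ℝ) * β ^ (-(1 / 2 : ℝ)) = 1 := by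
      rw [← Real.rpow_add hβ, show (1 / 2 : ℝ) + -(1 / 2) = 0 by norm_num, Real.rpow_zero]
    have hYh : 0 < Y ^ (-(1 / 2 : ℝ)) := Real.rpow_pos_of_pos hy0 _
    calc |f z| ≤ C / Y := hfC z hz
      _ ≤ |C| / Y := div_le_div_of_nonneg_right (le_abs_self C) hy0.le
      _ = |C| * (Y ^ (-(1 / 2 : ℝ)) * Y ^ (-(1 / 2 : ℝ))) := by
          rw [div_eq_mul_inv, inv_eq_rpow_mul (1 / 2) hy0, show (1 : ℝ) - 1 / 2 = 1 / 2 by norm_num]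
      _ = |C| * β ^ (1 / 2 : ℝ) * Y ^ (-(1 / 2 : ℝ)) * (β ^ (-(1 / 2 : ℝ)) * Y ^ (-(1 / 2 : ℝ))) := by
          linear_combination (-(|C| * Y ^ (-(1 / 2 : ℝ)) * Y ^ (-(1 / 2 : ℝ)))) * hβinv
      _ ≤ |C| * β ^ (1 / 2 : ℝ) * Y ^ (-(1 / 2 : ℝ)) * ∏ l : Fin (n + 1), |tv z l - t₀| ^ (-δ) :=
          mul_le_mul_of_nonneg_left hprod (by positivity)

/-! ### The log-cone estimate -/

/-- **The `K`-fibre log-cone estimate** (`K = n + 1` fibres over a one-dimensional base). If on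
a measurable set `W` with `0 < |y − y₀| ≤ R` every fibre satisfies `0 < |tₗ − cₗ| < R`, the fibres
of `S` stay above the cone, `α |y − y₀| ≤ |tₗ − cₗ|` (`α > 0`), and
`|f| ≤ C ∏_{l ∈ S} 1/|tₗ − cₗ|` on `W` with `f` a.e.-strongly measurable there, then `f` is
integrable on `W`. [folklore] -/
theorem integrableOn_logConeK {n : ℕ} {f : (Fin (0 + 1 + (n + 1)) → ℝ) → ℝ}
    {W : Set (Fin (0 + 1 + (n + 1)) → ℝ)} (hWm : MeasurableSet W)
    (hf : AEStronglyMeasurable f (volume.restrict W)) {y₀ α C R : ℝ} {c : Fin (n + 1) → ℝ}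
    (S : Finset (Fin (n + 1))) (hα : 0 < α)
    (hW : ∀ z ∈ W, (0 < |yv z - y₀| ∧ |yv z - y₀| ≤ R) ∧ (∀ l, 0 < |tv z l - c l| ∧ |tv z l - c l| < R) ∧
      ∀ l ∈ S, α * |yv z - y₀| ≤ |tv z l - c l|)
    (hfC : ∀ z ∈ W, |f z| ≤ C * ∏ l ∈ S, 1 / |tv z l - c l|) : IntegrableOn f W := by
  classical
  set δ : ℝ := 1 / (2 * ((n : ℝ) + 1)) with hδ
  have hn1 : (0 : ℝ) < (n : ℝ) + 1 := by positivity
  have hδ0 : 0 < δ := by rw [hδ]; positivity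
  have hδ1 : δ < 1 := by
    rw [hδ, div_lt_one (by positivity)]; nlinarith
  have hSδ : δ * (S.card : ℝ) ≤ 1 / 2 := by
    have hc : (S.card : ℝ) ≤ (n : ℝ) + 1 := by
      have := S.card_le_univ; rw [Fintype.card_fin] at this; exact_mod_cast this
    calc δ * (S.card : ℝ) ≤ δ * ((n : ℝ) + 1) := mul_le_mul_of_nonneg_left hc hδ0.le
      _ = 1 / 2 := by rw [hδ]; field_simp
  refine integrableOn_of_subpower hWm hf (y₀ := y₀) (γ₀ := δ * S.card) (C := |C| * α ^ (-(δ * S.card)))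
    (R := R + 1) (c := c) (γ := fun l => if l ∈ S then 1 - δ else 0) (by linarith) (fun l => ?_)
    (fun z hz => ?_) (fun z hz => ?_)
  · show (if l ∈ S then 1 - δ else 0) < 1
    split_ifs <;> linarith
  · obtain ⟨⟨hy0, hyR⟩, ht, -⟩ := hW z hz
    exact ⟨⟨hy0, by linarith⟩, fun l => ⟨(ht l).1, by linarith [(ht l).2]⟩⟩
  · obtain ⟨⟨hy0, -⟩, ht, hS⟩ := hW z hz
    set Y := |yv z - y₀| with hY
    have hαY : 0 < α * Y := mul_pos hα hy0
    -- each factor of `S`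
    have hl : ∀ l ∈ S, 1 / |tv z l - c l| ≤ (α * Y) ^ (-δ) * |tv z l - c l| ^ (-(1 - δ)) := by
      intro l hlS
      rw [one_div, inv_eq_rpow_mul δ (ht l).1, mul_comm]
      exact mul_le_mul_of_nonneg_right (Real.rpow_le_rpow_of_nonpos hαY (hS l hlS) (by linarith))
        (Real.rpow_nonneg (abs_nonneg _) _)
    have hprodS : ∏ l ∈ S, 1 / |tv z l - c l| ≤
        ((α * Y) ^ (-δ)) ^ S.card * ∏ l ∈ S, |tv z l - c l| ^ (-(1 - δ)) := by
      rw [← Finset.prod_const, ← Finset.prod_mul_distrib]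
      exact Finset.prod_le_prod (fun l _ => by positivity) hl
    have hpow : ((α * Y) ^ (-δ)) ^ S.card = α ^ (-(δ * S.card)) * Y ^ (-(δ * S.card)) := by
      rw [← Real.rpow_mul_natCast hαY.le, show -δ * (S.card : ℝ) = -(δ * S.card) by ring,
        Real.mul_rpow hα.le hy0.le]
    -- the other factors are `1`
    have hrest : ∏ l ∈ S, |tv z l - c l| ^ (-(1 - δ)) =
        ∏ l, |tv z l - c l| ^ (-(if l ∈ S then 1 - δ else 0)) := by
      rw [← Finset.prod_subset (f := fun l => |tv z l - c l| ^ (-(if l ∈ S then 1 - δ else 0)))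
        (Finset.subset_univ S) (fun l _ hl => by simp only [if_neg hl, neg_zero, Real.rpow_zero])]
      exact Finset.prod_congr rfl fun l hl => by simp only [if_pos hl]
    rw [hpow, hrest] at hprodS
    have hP0 : 0 ≤ ∏ l, |tv z l - c l| ^ (-(if l ∈ S then 1 - δ else 0)) :=
      Finset.prod_nonneg fun l _ => Real.rpow_nonneg (abs_nonneg _) _
    calc |f z| ≤ C * ∏ l ∈ S, 1 / |tv z l - c l| := hfC z hz
      _ ≤ |C| * ∏ l ∈ S, 1 / |tv z l - c l| :=
          mul_le_mul_of_nonneg_right (le_abs_self C) (Finset.prod_nonneg fun l _ => by positivity)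
      _ ≤ |C| * (α ^ (-(δ * S.card)) * Y ^ (-(δ * S.card)) *
            ∏ l, |tv z l - c l| ^ (-(if l ∈ S then 1 - δ else 0))) :=
          mul_le_mul_of_nonneg_left hprodS (abs_nonneg C)
      _ = |C| * α ^ (-(δ * S.card)) * Y ^ (-(δ * ↑S.card)) *
            ∏ l, |tv z l - c l| ^ (-(if l ∈ S then 1 - δ else 0)) := by ring

end RebaseChain

/-- Registered support goal of this file (part of `rebaseSimpleZeroMany_common`): the `K`-fibre
cone estimate at a pinch vertex over a one-dimensional base (`RebaseChain.integrableOn_coneK`). -/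
theorem rebaseSimpleZeroMany_coneK (n : ℕ) (f : (Fin (0 + 1 + (n + 1)) → ℝ) → ℝ) (W : Set (Fin (0 + 1 + (n + 1)) → ℝ)) (hWm : MeasurableSet W) (hf : AEStronglyMeasurable f (volume.restrict W)) (y₀ t₀ β C R : ℝ) (hβ : 0 < β) (hW : ∀ z ∈ W, (0 < |RebaseZero.yv z - y₀| ∧ |RebaseZero.yv z - y₀| ≤ R) ∧ ∀ l, 0 < |RebaseZero.tv z l - t₀| ∧ |RebaseZero.tv z l - t₀| < β * |RebaseZero.yv z - y₀|) (hfC : ∀ z ∈ W, |f z| ≤ C / |RebaseZero.yv z - y₀|) : IntegrableOn f W :=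
  RebaseChain.integrableOn_coneK hWm hf hβ hW hfC

end Summit.KontsevichZagierPeriods.ArrangementNormalForm.JanusBands
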